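import Summits.KontsevichZagierPeriods.KontsevichZagierPeriods.Theorems.SoloBlindDilogPieces
import Summits.KontsevichZagierPeriods.KontsevichZagierPeriods.Theorems.SoloBlindSerretReps
import HarnessLib

/-!
# Euler's dilogarithm identity `Li₂(½) = π²/12 - ½ log²2` inside the Kontsevich–Zagier rules, II

Continuation of `SoloBlindDilogPieces` (moves 1–2: the dissection `Λ₂ = D + U + P` of
Kontsevich's simplex representation of `ζ(2)` and the reflection `[D] ≡ [U]`).  Here:

3. the affine chart `(t₀,t₁) ↦ (2t₀, 2-2t₁)` (rule (2), `|det| = 4`) maps the rectangle `P` onto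
   the square `(1,2)²` with integrand `1/(u₀u₁)`;
4. which is, up to a null set, the Fubini product `ℓ × ℓ` of the logarithmic cell
   `ℓ = [[1,2], dx/x]` of `log 2`.

Hence `[Λ₂] - 2·[D] - [ℓ × ℓ] ∈ relations` (`simplexTwo_sub_sub`), `[Λ₂] = 2·[D] + [ℓ]²` in the
formal period ring (`mkQ_simplexTwo`), and **Euler's identity
`Li₂(½) = ∫_{0<t₁<t₀<½} dt₀dt₁/(t₀(1-t₁)) = π²/12 - log²2/2`** is read off through the evaluation
map (`dilogRep_value`) — a dilogarithm identity proved by Kontsevich–Zagier's three rules alone.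
Also: `simplexTwo_equiv_zetaTwoRep` — Kontsevich's `Λ₂` IS Kontsevich–Zagier's `Z` of *Periods*
§1.2 up to the swap `t₀ ↔ t₁` (so `[D]` enters the homogeneous `(π, log 2)`-sector of
`SoloBlindHomogeneous`).
-/

noncomputable section

namespace Summit.KontsevichZagierPeriods.KontsevichZagierPeriods.Theorems

open Set MeasureTheory
open Literature.ModelTheory.ExponentialFields (IsSemialgebraic isSemialgebraic_setOf_eval_pos)
open MvPolynomial (aeval X)
open Literature.NumberTheory.Transcendental
open Literature.NumberTheory.Transcendental.KZ

namespace SoloBlind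

/-! ## Move 3: the affine chart `(t₀,t₁) ↦ (2t₀, 2-2t₁)` onto the square `(1,2)²` -/

/-- `σ(t) = (2t₀, 2-2t₁)`. -/
def dblChart (t : Fin 2 → ℝ) : Fin 2 → ℝ := ![2 * t 0, 2 - 2 * t 1]

/-- `Dσ` (constant). -/
def dblDeriv : (Fin 2 → ℝ) →L[ℝ] (Fin 2 → ℝ) :=
  ContinuousLinearMap.pi ![(2 : ℝ) • pr2 0, -((2 : ℝ) • pr2 1)]

/-- `σ` is differentiable with derivative `dblDeriv`. -/
theorem hasFDerivAt_dblChart (t : Fin 2 → ℝ) : HasFDerivAt dblChart dblDeriv t := by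
  rw [hasFDerivAt_pi']
  intro i
  have hrow : (pr2 i).comp dblDeriv = ![(2 : ℝ) • pr2 0, -((2 : ℝ) • pr2 1)] i :=
    ContinuousLinearMap.ext fun v => by simp [dblDeriv]
  rw [hrow]
  fin_cases i
  · simpa [dblChart] using (hasFDerivAt_apply (0 : Fin 2) t).const_mul 2
  · simpa [dblChart] using ((hasFDerivAt_apply (1 : Fin 2) t).const_mul 2).const_sub 2

/-- The matrix of `Dσ`. -/
theorem toMatrix_dblDeriv :
    LinearMap.toMatrix' ((dblDeriv : (Fin 2 → ℝ) →L[ℝ] (Fin 2 → ℝ)) :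
      (Fin 2 → ℝ) →ₗ[ℝ] (Fin 2 → ℝ)) = !![2, 0; 0, -2] := by
  ext i j
  rw [LinearMap.toMatrix'_apply, ContinuousLinearMap.coe_coe]
  fin_cases i <;> fin_cases j <;> simp [dblDeriv]

/-- `|det Dσ| = 4`. -/
theorem abs_det_dblDeriv : |dblDeriv.det| = 4 := by
  rw [ContinuousLinearMap.det, ← LinearMap.det_toMatrix', toMatrix_dblDeriv, Matrix.det_fin_two]
  norm_num

/-- `σ` is injective. -/
theorem injective_dblChart : Function.Injective dblChart := by
  intro s t h
  have h0 := congrFun h 0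
  have h1 := congrFun h 1
  simp only [dblChart, Matrix.cons_val_zero, Matrix.cons_val_one] at h0 h1
  funext i
  fin_cases i
  · show s 0 = t 0
    linarith
  · show s 1 = t 1
    linarith

/-- `σ(P) = (1,2)²`. -/
theorem image_dblChart : dblChart '' rectDom = sqDom := by
  ext u
  constructor
  · rintro ⟨t, ⟨h1, h1', h0, h0'⟩, rfl⟩
    refine ⟨?_, ?_, ?_, ?_⟩ <;>
      simp only [dblChart, Matrix.cons_val_zero, Matrix.cons_val_one] <;> linarith
  · rintro ⟨h0, h0', h1, h1'⟩
    refine ⟨![u 0 / 2, 1 - u 1 / 2], ⟨?_, ?_, ?_, ?_⟩, ?_⟩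
    · show 0 < 1 - u 1 / 2
      linarith
    · show 2 * (1 - u 1 / 2) < 1
      linarith
    · show 1 < 2 * (u 0 / 2)
      linarith
    · show u 0 / 2 < 1
      linarith
    · funext i
      fin_cases i
      · show 2 * (u 0 / 2) = u 0
        ring
      · show 2 - 2 * (1 - u 1 / 2) = u 1
        ring

/-- `σ` is a `ℚ`-polynomial map. -/
theorem isSemialgebraicMapOn_dblChart : IsSemialgebraicMapOn ℚ rectDom dblChart := by
  refine IsSemialgebraicMapOn.of_forall isSemialgebraic_rectDom fun i => ?_
  fin_cases i
  · exact (isSemialgebraicFunOn_aeval isSemialgebraic_rectDom (2 * X 0)).congr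
      fun t _ => by simp [dblChart]
  · exact (isSemialgebraicFunOn_aeval isSemialgebraic_rectDom (2 - 2 * X 1)).congr
      fun t _ => by simp [dblChart]

/-- The pull-back identity `1/(t₀(1-t₁)) = 1/(u₀u₁) · 4` along `σ`. -/
theorem dilogFun_eq_dbl {t : Fin 2 → ℝ} (ht : t ∈ rectDom) :
    dilogFun t = 1 / (dblChart t 0 * dblChart t 1) * 4 := by
  have h0 : t 0 ≠ 0 := by linarith [ht.2.2.1]
  have h1 : 1 - t 1 ≠ 0 := by linarith [ht.2.1]
  simp only [dilogFun, dblChart, Matrix.cons_val_zero, Matrix.cons_val_one]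
  field_simp
  ring

/-- `[(1,2)², du₀du₁/(u₀u₁)]`, with convergence transported from `P` along `σ`. -/
def sqRep : IntegralRep 2 :=
  ratRep sqDom (fun u => 1 / (u 0 * u 1)) 1 (X 0 * X 1) isSemialgebraic_sqDom
    (fun u hu => by
      simpa using mul_ne_zero (by linarith [hu.1] : (0 : ℝ) < u 0).ne'
        (by linarith [hu.2.2.1] : (0 : ℝ) < u 1).ne')
    (fun u _ => by simp)
    (by
      rw [← image_dblChart]
      exact (integrableOn_iff_of_chart measurableSet_rectDom (fun t _ => hasFDerivAt_dblChart t)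
        injective_dblChart.injOn (fun _ _ => abs_det_dblDeriv) (f := dilogFun)
        (g := fun u => 1 / (u 0 * u 1)) fun _ ht => dilogFun_eq_dbl ht).mpr
        (integrableOn_dilogFun rectDom_subset measurableSet_rectDom))

/-- **Move 3** (rule (2)): `[P] ≡ [(1,2)², du₀du₁/(u₀u₁)]`. -/
theorem rectRep_equiv_sqRep : Equivalent rectRep sqRep :=
  equivalent_of_chart isSemialgebraicMapOn_dblChart (fun t _ => hasFDerivAt_dblChart t)
    injective_dblChart.injOn image_dblChart (fun _ _ => abs_det_dblDeriv)
    (fun _ ht => dilogFun_eq_dbl ht) rfl (fun _ _ => rfl) rfl fun _ _ => rfl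

/-! ## Move 4: the square is the Fubini product `ℓ × ℓ` -/

-- `logTwoCell = L(1;2) = [[1,2], dx/x]` and `logTwoCell_value` come from `SoloBlindSerretReps`.

/-- **Move 4** (a null set): `[(1,2)², du₀du₁/(u₀u₁)] - [ℓ × ℓ] ∈ relations`. -/
theorem sqRep_sub_prod : of sqRep - of (logTwoCell.prod logTwoCell) ∈ relations := by
  have hdom : (logTwoCell.prod logTwoCell).domain =
      {u : Fin 2 → ℝ | u 0 ∈ Icc (1 : ℝ) 2 ∧ u 1 ∈ Icc (1 : ℝ) 2} := by
    ext u
    simp only [logTwoCell, IntegralRep.prod_domain, IntegralRep.mem_prodDomain, logCell_eq,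
      logSeg_domain, line, mem_setOf_eq]
    exact Iff.rfl
  refine of_sub_of_mem_relations_of_null _ _ ?_ ?_ fun u hu => ?_
  · exact measure_mono_null (fun u ⟨hs, hn⟩ => absurd (hdom ▸
      ⟨⟨hs.1.le, hs.2.1.le⟩, ⟨hs.2.2.1.le, hs.2.2.2.le⟩⟩) hn) measure_empty
  · have hc : ∀ (i : Fin 2) (c : ℝ), volume {t : Fin 2 → ℝ | t i = c} = 0 := fun i c => by
      rw [volume_pi]; exact Measure.pi_hyperplane (fun _ : Fin 2 => (volume : Measure ℝ)) i c
    refine measure_mono_null (fun u ⟨hp, hn⟩ => ?_)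
      (measure_union_null (measure_union_null (hc 0 1) (hc 0 2))
        (measure_union_null (hc 1 1) (hc 1 2)))
    rw [hdom] at hp
    obtain ⟨⟨h0, h0'⟩, ⟨h1, h1'⟩⟩ := hp
    have hn' : ¬(1 < u 0 ∧ u 0 < 2 ∧ 1 < u 1 ∧ u 1 < 2) := hn
    by_contra hc
    simp only [mem_union, mem_setOf_eq, not_or] at hc
    obtain ⟨⟨hc1, hc2⟩, hc3, hc4⟩ := hc
    exact hn' ⟨lt_of_le_of_ne h0 (Ne.symm hc1), lt_of_le_of_ne h0' hc2,
      lt_of_le_of_ne h1 (Ne.symm hc3), lt_of_le_of_ne h1' hc4⟩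
  · show 1 / (u 0 * u 1) = (logTwoCell.prod logTwoCell).integrand u
    rw [IntegralRep.prod_integrand_eq, IntegralRep.prodFun_apply]
    simp only [logTwoCell, logCell_eq, logSeg_integrand, Rat.cast_one]
    rw [one_div_mul_one_div]
    rfl

/-! ## Kontsevich's `Λ₂` is Kontsevich–Zagier's `Z`, with the coordinates swapped -/

/-- **`Λ₂ ≡ Z`**: the swap `t₀ ↔ t₁` carries `Λ₂ = [t₁ < t₀, dt/(t₀(1-t₁))]` onto
Kontsevich–Zagier's `Z = [x < y, dx dy/((1-x)y)]` — one permutation move, then equal data. -/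
theorem simplexTwo_equiv_zetaTwoRep : Equivalent simplexTwo zetaTwoRep := by
  have h1 : of zetaTwoRep - of (zetaTwoRep.reindex (Equiv.swap 0 1)) ∈ relations :=
    of_sub_of_reindex_mem_relations zetaTwoRep (Equiv.swap 0 1)
  have hdom : (zetaTwoRep.reindex (Equiv.swap 0 1)).domain = simplexTwo.domain := by
    ext t
    rw [mem_simplexTwo_domain]
    show (fun i => t (Equiv.swap 0 1 i)) ∈ kzTriangle ↔ _
    rw [mem_kzTriangle]
    simp only [Equiv.swap_apply_left, Equiv.swap_apply_right]
  have h2 : of simplexTwo - of (zetaTwoRep.reindex (Equiv.swap 0 1)) ∈ relations := by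
    refine of_sub_of_mem_relations_of_null _ _ ?_ ?_ fun t _ => ?_
    · rw [hdom, sdiff_self]; exact measure_empty
    · rw [hdom, sdiff_self]; exact measure_empty
    · rw [simplexTwo_integrand_eq]
      show dilogFun t = zetaTwoRep.integrand (fun i => t (Equiv.swap 0 1 i))
      simp only [dilogFun, zetaTwoRep, ratRep_integrand, Equiv.swap_apply_left,
        Equiv.swap_apply_right, mul_comm (t 0)]
  have h : of simplexTwo - of zetaTwoRep = (of simplexTwo - of (zetaTwoRep.reindex
      (Equiv.swap 0 1))) - (of zetaTwoRep - of (zetaTwoRep.reindex (Equiv.swap 0 1))) := by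
    abel
  show of simplexTwo - of zetaTwoRep ∈ relations
  rw [h]
  exact sub_mem h2 h1

/-! ## `[Λ₂] = 2·[D] + [ℓ]²` and Euler's identity -/

/-- **Euler's dilogarithm identity inside the rules**:
`[Λ₂] - 2·[D] - [ℓ × ℓ] ∈ relations` (four moves). -/
theorem simplexTwo_sub_sub :
    of simplexTwo - 2 • of dilogRep - of (logTwoCell.prod logTwoCell) ∈ relations := by
  have e : of simplexTwo - 2 • of dilogRep - of (logTwoCell.prod logTwoCell) =
      (of simplexTwo - of dilogRep - of upperDilogRep - of rectRep) -
        (of dilogRep - of upperDilogRep) + (of rectRep - of sqRep) +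
        (of sqRep - of (logTwoCell.prod logTwoCell)) := by
    abel
  rw [e]
  exact add_mem (add_mem (sub_mem simplexTwo_dissect dilogRep_equiv_upper) rectRep_equiv_sqRep)
    sqRep_sub_prod

/-- In the formal period ring: `[Λ₂] = 2·[D] + [ℓ]²`. -/
theorem mkQ_simplexTwo :
    mkQ (of simplexTwo) = 2 • mkQ (of dilogRep) + mkQ (of logTwoCell) ^ 2 := by
  rw [sq, ← mkQ_mul, of_mul_of, ← map_nsmul, ← map_add, mkQ_eq_mkQ_iff]
  simpa [sub_sub] using simplexTwo_sub_sub

/-- `value Λ₂ = π²/6`. -/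
theorem simplexTwo_value : simplexTwo.value = Real.pi ^ 2 / 6 := by
  rw [simplexZetaRep_value, multipleZeta_singleton_eq_zetaValue le_rfl,
    show zetaValue 2 = Real.pi ^ 2 / 6 from hasSum_zeta_two.tsum_eq]

/-- **Euler: `Li₂(½) = ∫_{0<t₁<t₀<½} dt₀dt₁/(t₀(1-t₁)) = π²/12 - log²2/2`**, read off from the
moves. -/
theorem dilogRep_value : dilogRep.value = Real.pi ^ 2 / 12 - Real.log 2 ^ 2 / 2 := by
  have h := relations_le_ker_eval_holds simplexTwo_sub_sub
  rw [AddMonoidHom.mem_ker, map_sub, map_sub, map_nsmul, eval_of, eval_of, eval_of,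
    IntegralRep.value_prod, simplexTwo_value, logTwoCell_value] at h
  rw [nsmul_eq_mul, Nat.cast_ofNat] at h
  linarith

/-- **The Kontsevich–Zagier conjecture for the pair (`Λ₂`, `D ⊔ D ⊔ ℓ×ℓ`)**: any representation
KZ-equivalent to `2[D] + [ℓ × ℓ]` is KZ-equivalent to Kontsevich's `Λ₂`. -/
theorem kz_dilog {m : ℕ} (r' : IntegralRep m)
    (hr' : of r' - 2 • of dilogRep - of (logTwoCell.prod logTwoCell) ∈ relations) :
    Equivalent simplexTwo r' := by
  have e : of simplexTwo - of r' = (of simplexTwo - 2 • of dilogRep -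
      of (logTwoCell.prod logTwoCell)) - (of r' - 2 • of dilogRep -
      of (logTwoCell.prod logTwoCell)) := by abel
  show of simplexTwo - of r' ∈ relations
  rw [e]
  exact sub_mem simplexTwo_sub_sub hr'

end SoloBlind

end Summit.KontsevichZagierPeriods.KontsevichZagierPeriods.Theorems
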